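import Literature.Topology.PlanarFoliations.LimitCycles
import Literature.Topology.PlanarFoliations.BandOpen
import Literature.Topology.FourManifolds.TautFoliationsSaturation
import HarnessLib

/-!
# Regions of image-null closed leaves and their frontiers

Topic: Topology / PlanarFoliations, sequel to `BandOpen.lean`, `FrontierLeaves.lean`,
`LimitSets.lean`, `LimitCycles.lean`, `Kneser.lean`. Let `F` be a bi-oriented, transversely
oriented foliation of a punctured plane region (`PunctureData`), `f` the foliated map, and `V`
the open set of points with **image-null compact leaf** (`ImageNull`). For an open, connected,
saturated set `W ⊆ V` (a component of `V`: one of the regions `Vᵢ` of Camacho–Lins Neto, Ch. VII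
§2 Prop. 1) we analyse the frontier:

* `not_imageNull_of_mem_omegaSet` (+ α) (**proved**): a compact leaf carrying an ω-limit point of
  an open leaf is not image-null (`LimitCycles.not_homotopic_refl_map_of_mem_omegaSet`).
* `isCompact_or_of_mem_frontier` (**proved**): **a frontier leaf of `W` is compact or a
  separatrix** (open, its limit sets single punctures, one of the finitely many level leaves):
  "`∂Vᵢ` is either a closed orbit or a graph".
* `not_mem_and_mem_of_lt_of_lt` (**proved**): on the vertical of a flow box through a point
  `k` of a compact leaf `K`, two points at heights below and above that of `k` are neither both in
  the inner nor both in the outer domain of `ι(K)` (the sweep argument of `Kneser.lean`).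
* `exists_Ioo_subset_of_mem_frontier` (**proved**): **if a compact leaf `E` lies in the frontier
  of `W`, then `W` contains a one-sided band at `E`**: all the points of the vertical through a
  point of `E` at heights in `(s, s + δ)`, or all those at heights in `(s - δ, s)`. Otherwise
  the heights of `W` on that vertical have gaps accumulating at `s`; a gap end point lies on a
  frontier leaf, which for small gaps is compact (the finitely many separatrices cross the
  vertical finitely often near `E`, by `closure_image_leaf`), and a compact frontier leaf between
  two heights of `W` separates the connected `W` (previous lemma).

All statements are [folklore].
-/

noncomputable section

open Set Filter Function Bornology Metric
open _root_.Topology unitInterval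
open Literature.Topology.FourManifolds Literature.Topology.FourManifolds.Foliation
  Literature.Topology.FourManifolds.OneManifold Literature.Topology.PlaneTopology

namespace Literature.Topology.PlanarFoliations

variable {X : Type*} [TopologicalSpace X] [T2Space X] [SecondCountableTopology X] {F : Foliation ℝ X} {x : X}
variable {hbi : IsBiOriented F} {ι : X → ℂ} {e : OpenPartialHomeomorph X (ℝ × ℝ)}
variable {B : Type*} [NormedAddCommGroup B] [LocallyConnectedSpace B] {M : Type*} [TopologicalSpace M]
  {T : Foliation B M} {f : X → M} {g : ℂ → M}

/-! ## Limit cycles are not image-null -/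

/-- **A compact leaf carrying an ω-limit point of an open leaf is not image-null.** [folklore] -/
theorem not_imageNull_of_mem_omegaSet [NoncompactSpace (F.Leaf x)] (hbi : IsBiOriented F) (hι : IsOpenEmbedding ι)
    (ho : F.IsTransverselyOriented) (hf : IsFoliatedMap F T f) {y : X} (hy : ι y ∈ omegaSet hbi ι x)
    (hK : IsCompact (F.leaf y)) : ¬ ImageNull hf y := by
  intro hIN
  obtain ⟨γ, hc, hp, hinj, -⟩ := exists_leafLoop_of_isCompact (x := y) hbi hK
  exact not_homotopic_refl_map_of_mem_omegaSet hbi hι ho hf hc hp hinj hy (hIN.map_loop γ hc hp hinj (F.mem_leaf_self y))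

/-- **A compact leaf carrying an α-limit point of an open leaf is not image-null.** [folklore] -/
theorem not_imageNull_of_mem_alphaSet [NoncompactSpace (F.Leaf x)] (hbi : IsBiOriented F) (hι : IsOpenEmbedding ι)
    (ho : F.IsTransverselyOriented) (hf : IsFoliatedMap F T f) {y : X} (hy : ι y ∈ alphaSet hbi ι x)
    (hK : IsCompact (F.leaf y)) : ¬ ImageNull hf y := by
  intro hIN
  obtain ⟨γ, hc, hp, hinj, -⟩ := exists_leafLoop_of_isCompact (x := y) hbi hK
  exact not_homotopic_refl_map_of_mem_alphaSet hbi hι ho hf hc hp hinj hy (hIN.map_loop γ hc hp hinj (F.mem_leaf_self y))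

/-! ## Frontier leaves of a region of image-null leaves -/

namespace PunctureData

variable (D : PunctureData F ι T g)

omit [LocallyConnectedSpace B] in
/-- **A frontier leaf of a saturated set of image-null leaves is compact or a separatrix.** Let
`W` be saturated with image-null (hence compact) leaves, `y` a point of its frontier whose leaf
has its points in a compact set `C ⊆ Ω`. Then the leaf of `y` is compact, or it is open with
ω- and α-limit sets single punctures, and is a level leaf of each. [folklore] -/
theorem isCompact_or_of_mem_frontier (hι : IsOpenEmbedding ι) {W : Set X} (hWsat : F.IsSaturated W)
    (hWV : ∀ w ∈ W, ImageNull D.foliated w) {C : Set ℂ} (hC : IsCompact C) (hCΩ : C ⊆ D.Ω) {y : X}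
    (hy : y ∈ frontier W) (hmem : ∀ q : F.Leaf y, ι (Leaf.pt q) ∈ C) :
    IsCompact (F.leaf y) ∨ ∃ _ : NoncompactSpace (F.Leaf y),
      (∃ v ∈ D.P, omegaSet hbi ι y = {v} ∧ ∃ s ∈ D.levelLeaves v, y ∈ F.leaf s) ∧
      (∃ v ∈ D.P, alphaSet hbi ι y = {v} ∧ ∃ s ∈ D.levelLeaves v, y ∈ F.leaf s) := by
  by_cases hcy : IsCompact (F.leaf y)
  · exact Or.inl hcy
  · haveI := noncompactSpace_leaf_of_not_isCompact' hcy
    have hL : F.leaf y ⊆ closure W := hWsat.closure y hy.1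
    have hVc : ∀ v ∈ W, IsCompact (F.leaf v) := fun v hv ↦ (hWV v hv).isCompact_leaf
    have hP : ∀ {z}, z ∈ C → z ∉ range ι → z ∈ D.P := fun {z} hz hzr ↦ by
      by_contra hzP
      exact hzr (D.mem_range (hCΩ hz) hzP)
    have hωP : omegaSet hbi ι y ⊆ D.P := fun z hz ↦ hP (omegaSet_subset_of_forall_mem hC.isClosed hmem hz) (by
      rintro ⟨y', rfl⟩; exact not_mem_omegaSet_of_subset_closure hι hVc hL y' hz)
    have hαP : alphaSet hbi ι y ⊆ D.P := fun z hz ↦ hP (alphaSet_subset_of_forall_mem hC.isClosed hmem hz) (by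
      rintro ⟨y', rfl⟩; exact not_mem_alphaSet_of_subset_closure hι hVc hL y' hz)
    exact Or.inr ⟨inferInstance, D.exists_omegaSet_eq_singleton hι hC hmem hωP, D.exists_alphaSet_eq_singleton hι hC hmem hαP⟩

end PunctureData

/-! ## Two heights on the vertical through a point of a compact leaf lie on different sides -/

/-- The sweep argument: for two complementary pieces `C₁`, `C₂` of the complement of the image of
a compact leaf `K` (open, disjoint, covering it), with `ι k ∈ closure C₂` for a point `k ∈ K` of a
flow box, two points of the vertical through `k` below and above `k` are not both in `C₁`.
[folklore] -/
theorem not_mem_and_mem_of_lt_of_lt_aux (hbi : IsBiOriented F) (hι : IsOpenEmbedding ι) {y : X} (hK : IsCompact (F.leaf y))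
    (he : e ∈ F.atlas) {k : X} (hk : k ∈ F.leaf y) (hke : k ∈ e.source) {C₁ C₂ : Set ℂ} (h₁o : IsOpen C₁) (h₂o : IsOpen C₂)
    (hdisj : Disjoint C₁ C₂) (hcover : ∀ z ∉ ι '' F.leaf y, z ∈ C₁ ∨ z ∈ C₂) (h₂K : Disjoint C₂ (ι '' F.leaf y))
    (hfr : ι k ∈ closure C₂) {t₁ t₂ : ℝ} (ht₁ : t₁ < (e k).2) (ht₂ : (e k).2 < t₂) :
    ¬ (ι (e.symm ((e k).1, t₁)) ∈ C₁ ∧ ι (e.symm ((e k).1, t₂)) ∈ C₁) := by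
  haveI : Nontrivial X := nontrivial_of_foliation F y
  rintro ⟨hz₁, hz₂⟩
  set u₀ := (e k).1 with hu₀
  set s := (e k).2 with hs
  have hkeq : e.symm (u₀, s) = k := by rw [show (u₀, s) = e k from rfl, e.left_inv hke]
  -- `K` meets the vertical only at `k`, the plaques only at the plaque of `k`
  have hvertK : ∀ {t : ℝ}, e.symm (u₀, t) ∈ F.leaf y → t = s := fun {t} ht' ↦
    compactLeaf_vert_subsingleton hbi hι hK he ht' (by rw [hkeq]; exact hk)
  have hplaqueK : ∀ {t u : ℝ}, e.symm (u, t) ∈ F.leaf y → t = s := fun {t u} h ↦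
    hvertK (F.plaque_subset_leaf_of_mem he h (F.symm_mem_plaque he u t) (F.symm_mem_plaque he u₀ t))
  -- sweeping: a preconnected set of chart points off `K` with a point in `C₁` is in `C₁`
  have hsweep : ∀ {S : Set (ℝ × ℝ)}, IsPreconnected S → (∀ q ∈ S, e.symm q ∉ F.leaf y) →
      (∃ q ∈ S, ι (e.symm q) ∈ C₁) → ∀ q ∈ S, ι (e.symm q) ∈ C₁ := by
    intro S hS hSK ⟨q₀, hq₀, hq₀in⟩ q hq
    have himg : (fun q : ℝ × ℝ ↦ ι (e.symm q)) '' S ⊆ C₁ ∪ C₂ := by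
      rintro _ ⟨q', hq', rfl⟩
      exact hcover _ fun h ↦ hSK q' hq' ((hι.injective.mem_set_image).1 h)
    have hsub := (hS.image _ (isOpenEmbedding_symm he hι).continuous.continuousOn).subset_left_of_subset_union
      h₁o h₂o hdisj himg ⟨_, mem_image_of_mem _ hq₀, hq₀in⟩
    exact hsub (mem_image_of_mem _ hq)
  -- the punctured vertical halves are in `C₁`
  have hlow : ∀ t ∈ Ico t₁ s, ι (e.symm (u₀, t)) ∈ C₁ := fun t ht' ↦
    hsweep ((isPreconnected_Ico (a := t₁) (b := s)).image _ (continuous_const.prodMk continuous_id).continuousOn)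
      (by rintro _ ⟨τ, hτ, rfl⟩ h; exact absurd (hvertK h) (ne_of_lt hτ.2))
      ⟨(u₀, t₁), ⟨t₁, ⟨le_rfl, ht₁⟩, rfl⟩, hz₁⟩ (u₀, t) ⟨t, ht', rfl⟩
  have hhigh : ∀ t ∈ Ioc s t₂, ι (e.symm (u₀, t)) ∈ C₁ := fun t ht' ↦
    hsweep ((isPreconnected_Ioc (a := s) (b := t₂)).image _ (continuous_const.prodMk continuous_id).continuousOn)
      (by rintro _ ⟨τ, hτ, rfl⟩ h; exact absurd (hvertK h) (ne_of_gt hτ.1))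
      ⟨(u₀, t₂), ⟨t₂, ⟨ht₂, le_rfl⟩, rfl⟩, hz₂⟩ (u₀, t) ⟨t, ht', rfl⟩
  -- hence the box `ℝ × (t₁, t₂)` minus the plaque of `k` is in `C₁`
  have hbox : ∀ q : ℝ × ℝ, q.2 ∈ Ioo t₁ t₂ → q.2 ≠ s → ι (e.symm q) ∈ C₁ := by
    rintro ⟨u, t⟩ ht' hts
    have hrow : ∀ u', ι (e.symm (u', t)) ∈ C₁ → ι (e.symm (u, t)) ∈ C₁ := fun u' hu' ↦
      hsweep ((isPreconnected_univ (α := ℝ)).image _ (continuous_id.prodMk continuous_const).continuousOn)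
        (by rintro _ ⟨v, -, rfl⟩ h; exact hts (hplaqueK h)) ⟨(u', t), ⟨u', mem_univ _, rfl⟩, hu'⟩ (u, t) ⟨u, mem_univ _, rfl⟩
    rcases lt_or_gt_of_ne hts with h | h
    · exact hrow u₀ (hlow t ⟨ht'.1.le, h⟩)
    · exact hrow u₀ (hhigh t ⟨h, ht'.2.le⟩)
  -- but `ι k ∈ closure C₂`: a point of `C₂` in the open box around `k`
  set N : Set ℂ := (fun q : ℝ × ℝ ↦ ι (e.symm q)) '' (univ ×ˢ Ioo t₁ t₂) with hN
  have hNo : IsOpen N := (isOpenEmbedding_symm he hι).isOpenMap _ (isOpen_univ.prod isOpen_Ioo)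
  have hkN : ι k ∈ N := ⟨(u₀, s), ⟨mem_univ _, ht₁, ht₂⟩, by show ι (e.symm (u₀, s)) = ι k; rw [hkeq]⟩
  obtain ⟨z, hzN, hz₂'⟩ := mem_closure_iff.1 hfr N hNo hkN
  obtain ⟨q, ⟨-, hq⟩, rfl⟩ := hzN
  by_cases hqs : q.2 = s
  · refine disjoint_left.1 h₂K hz₂' (mem_image_of_mem ι ?_)
    have hq' : e.symm q ∈ plaque e s := by rw [show q = (q.1, s) from Prod.ext rfl hqs]; exact F.symm_mem_plaque he q.1 s
    rw [← leaf_eq_of_mem hk]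
    exact F.plaque_subset_leaf_of_mem he (F.mem_leaf_self k) (by rw [← hkeq]; exact F.symm_mem_plaque he u₀ s) hq'
  · exact disjoint_left.1 hdisj (hbox q hq hqs) hz₂'

/-- **On the vertical through a point `k` of a compact leaf `K`, a point below `k` and a point
above `k` are not both in the inner domain of `ι(K)`, nor both in the outer domain.** [folklore] -/
theorem not_same_side (hbi : IsBiOriented F) (hι : IsOpenEmbedding ι) {y : X} (hK : IsCompact (F.leaf y))
    (he : e ∈ F.atlas) {k : X} (hk : k ∈ F.leaf y) (hke : k ∈ e.source) {t₁ t₂ : ℝ} (ht₁ : t₁ < (e k).2)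
    (ht₂ : (e k).2 < t₂) :
    ¬ (ι (e.symm ((e k).1, t₁)) ∈ insideLeaf F ι y ∧ ι (e.symm ((e k).1, t₂)) ∈ insideLeaf F ι y) ∧
      ¬ (ι (e.symm ((e k).1, t₁)) ∈ outsideLeaf F ι y ∧ ι (e.symm ((e k).1, t₂)) ∈ outsideLeaf F ι y) := by
  obtain ⟨hUo, hVo, -, -, hfU, hfV, -, -⟩ := insideLeaf_spec hbi hι hK
  have hkU : ι k ∈ closure (insideLeaf F ι y) := frontier_subset_closure (hfU.symm ▸ mem_image_of_mem ι hk)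
  have hkV : ι k ∈ closure (outsideLeaf F ι y) := frontier_subset_closure (hfV.symm ▸ mem_image_of_mem ι hk)
  refine ⟨not_mem_and_mem_of_lt_of_lt_aux hbi hι hK he hk hke hUo hVo (disjoint_insideLeaf_outsideLeaf y)
      (fun z hz ↦ mem_insideLeaf_or_mem_outsideLeaf hz) (disjoint_left.2 fun z hz h ↦ hz.1 h) hkV ht₁ ht₂,
    not_mem_and_mem_of_lt_of_lt_aux hbi hι hK he hk hke hVo hUo (disjoint_insideLeaf_outsideLeaf y).symm
      (fun z hz ↦ (mem_insideLeaf_or_mem_outsideLeaf hz).symm) (disjoint_left.2 fun z hz h ↦ hz.1 h) hkU ht₁ ht₂⟩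

/-- **A connected set off a compact leaf `K` does not contain points of the vertical through a
point of `K` both below and above it.** [folklore] -/
theorem not_mem_and_mem_of_isPreconnected (hbi : IsBiOriented F) (hι : IsOpenEmbedding ι) {y : X}
    (hK : IsCompact (F.leaf y)) (he : e ∈ F.atlas) {k : X} (hk : k ∈ F.leaf y) (hke : k ∈ e.source) {t₁ t₂ : ℝ}
    (ht₁ : t₁ < (e k).2) (ht₂ : (e k).2 < t₂) {W : Set X} (hW : IsPreconnected W) (hWK : Disjoint W (F.leaf y)) :
    ¬ (e.symm ((e k).1, t₁) ∈ W ∧ e.symm ((e k).1, t₂) ∈ W) := by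
  rintro ⟨h₁, h₂⟩
  have hWc : IsPreconnected (ι '' W) := hW.image ι hι.continuous.continuousOn
  have hWK' : Disjoint (ι '' W) (ι '' F.leaf y) := by
    rw [disjoint_iff_inter_eq_empty, ← image_inter hι.injective, disjoint_iff_inter_eq_empty.1 hWK, image_empty]
  obtain ⟨hni, hno⟩ := not_same_side hbi hι hK he hk hke ht₁ ht₂
  obtain ⟨hUo, hVo, -⟩ := insideLeaf_spec hbi hι hK
  rcases hWc.subset_or_subset hUo hVo (disjoint_insideLeaf_outsideLeaf y)
    (fun z hz ↦ mem_insideLeaf_or_mem_outsideLeaf (disjoint_left.1 hWK' hz)) with h | h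
  · exact hni ⟨h (mem_image_of_mem ι h₁), h (mem_image_of_mem ι h₂)⟩
  · exact hno ⟨h (mem_image_of_mem ι h₁), h (mem_image_of_mem ι h₂)⟩

/-! ## A compact frontier leaf borders a one-sided band -/

namespace PunctureData

variable (D : PunctureData F ι T g)

omit [LocallyConnectedSpace B] in
/-- **Separatrices of the frontier cross a vertical finitely often near a compact frontier
leaf**: given a compact leaf `K ∌` the separatrices, there is `δ₁ > 0` such that every frontier
point of `W` on the vertical through the point `k ∈ K` of the flow box `e`, at a height within
`δ₁` of (and different from) that of `k`, has compact leaf. [folklore] -/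
theorem exists_forall_isCompact_of_mem_frontier (hbi : IsBiOriented F) (hι : IsOpenEmbedding ι) {W : Set X} (hWsat : F.IsSaturated W)
    (hWV : ∀ w ∈ W, ImageNull D.foliated w) {C : Set ℂ} (hC : IsCompact C) (hCΩ : C ⊆ D.Ω)
    (hWC : ∀ z ∈ closure W, ι z ∈ C) {k : X} (hK : IsCompact (F.leaf k)) (he : e ∈ F.atlas) (hke : k ∈ e.source) :
    ∃ δ₁ > (0 : ℝ), ∀ t : ℝ, t ≠ (e k).2 → |t - (e k).2| < δ₁ → e.symm ((e k).1, t) ∈ frontier W →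
      IsCompact (F.leaf (e.symm ((e k).1, t))) := by
  classical
  set u₀ := (e k).1 with hu₀
  set s := (e k).2 with hs
  have hkeq : e.symm (u₀, s) = k := by rw [show (u₀, s) = e k from rfl, e.left_inv hke]
  have hVc : ∀ v ∈ W, IsCompact (F.leaf v) := fun v hv ↦ (hWV v hv).isCompact_leaf
  have hcv : Continuous fun t : ℝ ↦ e.symm (u₀, t) :=
    (F.continuous_symm_of_mem he).comp (continuous_const.prodMk continuous_id)
  -- the finitely many base points of level leaves
  set SB : Set X := ⋃ v ∈ D.P, D.levelLeaves v with hSB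
  have hfin : SB.Finite := D.P_finite.biUnion fun v _ ↦ D.finite_levelLeaves v
  -- for a bad base point (open leaf in the closure of `W`), a vertical gap around `s`
  have hgap : ∀ b : X, ¬ IsCompact (F.leaf b) → F.leaf b ⊆ closure W →
      ∃ δ > (0 : ℝ), ∀ t : ℝ, t ≠ s → |t - s| < δ → e.symm (u₀, t) ∉ F.leaf b := by
    intro b hbc hbW
    haveI := noncompactSpace_leaf_of_not_isCompact' hbc
    by_contra hno
    push Not at hno
    -- `ι k` is in the closure of `ι L_b`
    have hcl : ι k ∈ closure (ι '' F.leaf b) := by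
      rw [Metric.mem_closure_iff]
      intro ε hε
      have hcont : ContinuousAt (fun t : ℝ ↦ ι (e.symm (u₀, t))) s := (hι.continuous.comp hcv).continuousAt
      obtain ⟨δ, hδ, hball⟩ := Metric.mem_nhds_iff.1 (hcont.preimage_mem_nhds (Metric.ball_mem_nhds _ hε))
      obtain ⟨t, hts, htδ, htb⟩ := hno δ hδ
      refine ⟨ι (e.symm (u₀, t)), mem_image_of_mem ι htb, ?_⟩
      have h := hball (show t ∈ Metric.ball s δ by rwa [Metric.mem_ball, Real.dist_eq])
      rw [mem_preimage, Metric.mem_ball, hkeq] at h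
      rwa [dist_comm]
    rw [closure_image_leaf (hbi := hbi) hι] at hcl
    rcases hcl with (h | h) | h
    · have hkb : k ∈ F.leaf b := (hι.injective.mem_set_image).1 h
      exact hbc (by rw [← leaf_eq_of_mem hkb]; exact hK)
    · exact not_mem_omegaSet_of_subset_closure hι hVc hbW k h
    · exact not_mem_alphaSet_of_subset_closure hι hVc hbW k h
  -- a uniform `δ₁` over the finitely many bad base points
  set δf : X → ℝ := fun b ↦ if h : ¬ IsCompact (F.leaf b) ∧ F.leaf b ⊆ closure W then (hgap b h.1 h.2).choose else 1 with hδf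
  have hδfpos : ∀ b, 0 < δf b := fun b ↦ by
    simp only [hδf]
    split_ifs with h
    · exact (hgap b h.1 h.2).choose_spec.1
    · exact one_pos
  have hδfspec : ∀ b, ∀ h : ¬ IsCompact (F.leaf b) ∧ F.leaf b ⊆ closure W,
      ∀ t : ℝ, t ≠ s → |t - s| < δf b → e.symm (u₀, t) ∉ F.leaf b := fun b h ↦ by
    simp only [hδf, dif_pos h]
    exact (hgap b h.1 h.2).choose_spec.2
  obtain ⟨δ₁, hδ₁, hδ₁le⟩ : ∃ δ₁ > (0 : ℝ), ∀ b ∈ SB, δ₁ ≤ δf b := by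
    rcases hfin.toFinset.eq_empty_or_nonempty with hemp | hne
    · exact ⟨1, one_pos, fun b hb ↦ by
        have : b ∈ hfin.toFinset := hfin.mem_toFinset.2 hb
        rw [hemp] at this; exact absurd this (Finset.notMem_empty b)⟩
    · obtain ⟨b₀, hb₀, hmin⟩ := hfin.toFinset.exists_min_image δf hne
      exact ⟨δf b₀, hδfpos b₀, fun b hb ↦ hmin b (hfin.mem_toFinset.2 hb)⟩
  refine ⟨δ₁, hδ₁, fun t hts htδ hfr ↦ ?_⟩
  -- a frontier point with open leaf would be on a separatrix crossing inside the gap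
  set z := e.symm (u₀, t) with hz
  by_contra hzc
  have hzcl : F.leaf z ⊆ closure W := hWsat.closure z hfr.1
  have hmemz : ∀ q : F.Leaf z, ι (Leaf.pt q) ∈ C := fun q ↦ hWC _ (hzcl q.2)
  rcases D.isCompact_or_of_mem_frontier (hbi := hbi) hι hWsat hWV hC hCΩ hfr hmemz with h | ⟨_, ⟨v, hv, -, b, hb, hzb⟩, -⟩
  · exact hzc h
  · have hbSB : b ∈ SB := mem_biUnion hv hb
    have hbad : ¬ IsCompact (F.leaf b) ∧ F.leaf b ⊆ closure W := by
      rw [← leaf_eq_of_mem hzb]; exact ⟨hzc, hzcl⟩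
    exact hδfspec b hbad t hts (htδ.trans_le (hδ₁le b hbSB)) hzb

omit [LocallyConnectedSpace B] in
/-- **A compact frontier leaf of a connected open saturated set of image-null leaves borders a
one-sided band of it.** Let `W` be open, saturated, preconnected, with image-null leaves and
closure mapped into a compact set `C ⊆ Ω`, and let `y ∈ ∂W` have compact leaf `E`. Then on the
vertical through `y` of a flow box `e ∋ y`, `W` contains all the points at heights in
`(s, s + δ)` or all those at heights in `(s - δ, s)` (`s` the height of `y`). [folklore] -/
theorem exists_Ioo_subset_of_mem_frontier (hbi : IsBiOriented F) (hι : IsOpenEmbedding ι) {W : Set X}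
    (hWo : IsOpen W) (hWsat : F.IsSaturated W) (hWconn : IsPreconnected W) (hWV : ∀ w ∈ W, ImageNull D.foliated w)
    {C : Set ℂ} (hC : IsCompact C) (hCΩ : C ⊆ D.Ω) (hWC : ∀ z ∈ closure W, ι z ∈ C) {y : X} (hy : y ∈ frontier W)
    (hK : IsCompact (F.leaf y)) (he : e ∈ F.atlas) (hye : y ∈ e.source) :
    ∃ δ > (0 : ℝ), (∀ t ∈ Ioo (e y).2 ((e y).2 + δ), e.symm ((e y).1, t) ∈ W) ∨
      (∀ t ∈ Ioo ((e y).2 - δ) (e y).2, e.symm ((e y).1, t) ∈ W) := by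
  set u₀ := (e y).1 with hu₀
  set s := (e y).2 with hs
  have hyeq : e.symm (u₀, s) = y := by rw [show (u₀, s) = e y from rfl, e.left_inv hye]
  have hcv : Continuous fun t : ℝ ↦ e.symm (u₀, t) :=
    (F.continuous_symm_of_mem he).comp (continuous_const.prodMk continuous_id)
  have hfrW : frontier W = closure W \ W := hWo.frontier_eq
  have hyW : y ∉ W := by have h := hy; rw [hfrW] at h; exact h.2
  have hycl : y ∈ closure W := by have h := hy; rw [hfrW] at h; exact h.1
  -- the heights of `W` on the vertical
  set H : Set ℝ := {t | e.symm (u₀, t) ∈ W} with hH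
  have hHo : IsOpen H := hWo.preimage hcv
  have hsH : s ∉ H := fun h ↦ hyW (by rw [← hyeq]; exact h)
  -- frontier points of `W` on the vertical, from limits of heights of `W`
  have hfr_of : ∀ {b : ℝ}, b ∉ H → b ∈ closure H → e.symm (u₀, b) ∈ frontier W := fun {b} hb hbcl ↦ by
    rw [hfrW]
    exact ⟨(map_mem_closure (f := fun t : ℝ ↦ e.symm (u₀, t)) (t := W) hcv hbcl fun t ht ↦ ht), hb⟩
  -- Step A: heights of `W` accumulate at `s`
  have hacc : ∀ ε > (0 : ℝ), ∃ t ∈ H, |t - s| < ε := by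
    intro ε hε
    have hca : ContinuousAt (fun w ↦ (e w).2) y := continuous_snd.continuousAt.comp (e.continuousAt hye)
    have hn : ((fun w ↦ (e w).2) ⁻¹' Metric.ball s ε) ∩ e.source ∈ 𝓝 y :=
      inter_mem (hca.preimage_mem_nhds (Metric.ball_mem_nhds s hε)) (e.open_source.mem_nhds hye)
    obtain ⟨w, ⟨hwε, hwe⟩, hwW⟩ := mem_closure_iff_nhds.1 hycl _ hn
    refine ⟨(e w).2, ?_, by rw [mem_preimage, Metric.mem_ball, Real.dist_eq] at hwε; exact hwε⟩
    show e.symm (u₀, (e w).2) ∈ W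
    refine hWsat w hwW ?_
    exact F.plaque_subset_leaf_of_mem he (F.mem_leaf_self w) (mem_plaque_self hwe) (F.symm_mem_plaque he u₀ _)
  -- Step C: frontier points on the vertical near `s` have compact leaves
  obtain ⟨δ₁, hδ₁, hcomp⟩ := D.exists_forall_isCompact_of_mem_frontier hbi hι hWsat hWV hC hCΩ hWC hK he hye
  -- the separation contradiction from a gap `b` with heights of `W` on both sides
  have hsep : ∀ {b h₁ h₂ : ℝ}, b ∉ H → b ∈ closure H → b ≠ s → |b - s| < δ₁ → h₁ ∈ H → h₂ ∈ H →
      h₂ < b → b < h₁ → False := by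
    intro b h₁ h₂ hbH hbcl hbs hbδ hh₁ hh₂ hlt₂ hlt₁
    have hfr := hfr_of hbH hbcl
    have hKb := hcomp b hbs hbδ hfr
    set zb := e.symm (u₀, b) with hzb
    have hzbe : zb ∈ e.source := e.map_target (F.mk_mem_target he u₀ b)
    have hezb : e zb = (u₀, b) := e.right_inv (F.mk_mem_target he u₀ b)
    have hdisj : Disjoint W (F.leaf zb) := by
      rw [disjoint_left]
      intro w hw hwz
      have h := (hWsat.frontier zb hfr) hwz
      rw [hfrW] at h
      exact h.2 hw
    have key := not_mem_and_mem_of_isPreconnected hbi hι hKb he (F.mem_leaf_self zb) hzbe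
      (t₁ := h₂) (t₂ := h₁) (by rw [hezb]; exact hlt₂) (by rw [hezb]; exact hlt₁) hWconn hdisj
    rw [hezb] at key
    exact key ⟨hh₂, hh₁⟩
  -- Step D, above
  have habove : (∀ ε > (0 : ℝ), ∃ t ∈ H, s < t ∧ t < s + ε) → ∃ δ > (0 : ℝ), Ioo s (s + δ) ⊆ H := by
    intro hup
    by_contra hno
    push Not at hno
    obtain ⟨h₁, hh₁, hsh₁, hh₁δ⟩ := hup δ₁ hδ₁
    obtain ⟨t', ht', ht'H⟩ := not_subset.1 (hno (h₁ - s) (by linarith))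
    have ht'lt : t' < h₁ := by linarith [ht'.2]
    -- the last gap before `h₁`
    set A : Set ℝ := Icc t' h₁ ∩ Hᶜ with hA
    have hAc : IsClosed A := isClosed_Icc.inter hHo.isClosed_compl
    have ht'A : t' ∈ A := ⟨⟨le_rfl, ht'lt.le⟩, ht'H⟩
    have hAne : A.Nonempty := ⟨t', ht'A⟩
    have hAbdd : BddAbove A := ⟨h₁, fun t ht ↦ ht.1.2⟩
    set b := sSup A with hb
    have hbA : b ∈ A := hAc.csSup_mem hAne hAbdd
    have hbH : b ∉ H := hbA.2
    have hblt : b < h₁ := lt_of_le_of_ne hbA.1.2 fun h ↦ hbH (h ▸ hh₁)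
    have hbgt : s < b := ht'.1.trans_le (le_csSup hAbdd ht'A)
    have hIoc : ∀ t, b < t → t ≤ h₁ → t ∈ H := fun t hbt hth ↦ by
      by_contra htH
      have : t ≤ b := le_csSup hAbdd ⟨⟨(hbA.1.1).trans hbt.le, hth⟩, htH⟩
      linarith
    have hbcl : b ∈ closure H := by
      rw [Metric.mem_closure_iff]
      intro ε hε
      set t₀ := min (b + ε / 2) h₁ with ht₀
      have h1 : b < t₀ := lt_min (by linarith) hblt
      have h2 : t₀ ≤ b + ε / 2 := min_le_left _ _
      refine ⟨t₀, hIoc _ h1 (min_le_right _ _), ?_⟩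
      rw [Real.dist_eq, abs_sub_comm, abs_of_pos (by linarith)]
      linarith
    obtain ⟨h₂, hh₂, hsh₂, hh₂b⟩ := hup (b - s) (by linarith)
    exact hsep hbH hbcl (ne_of_gt hbgt) (by rw [abs_of_pos (by linarith)]; linarith) hh₁ hh₂ (by linarith) hblt
  -- Step D, below
  have hbelow : (∀ ε > (0 : ℝ), ∃ t ∈ H, s - ε < t ∧ t < s) → ∃ δ > (0 : ℝ), Ioo (s - δ) s ⊆ H := by
    intro hdown
    by_contra hno
    push Not at hno
    obtain ⟨h₂, hh₂, hh₂δ, hh₂s⟩ := hdown δ₁ hδ₁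
    obtain ⟨t', ht', ht'H⟩ := not_subset.1 (hno (s - h₂) (by linarith))
    have ht'gt : h₂ < t' := by linarith [ht'.1]
    -- the first gap after `h₂`
    set A : Set ℝ := Icc h₂ t' ∩ Hᶜ with hA
    have hAc : IsClosed A := isClosed_Icc.inter hHo.isClosed_compl
    have ht'A : t' ∈ A := ⟨⟨ht'gt.le, le_rfl⟩, ht'H⟩
    have hAne : A.Nonempty := ⟨t', ht'A⟩
    have hAbdd : BddBelow A := ⟨h₂, fun t ht ↦ ht.1.1⟩
    set b := sInf A with hb
    have hbA : b ∈ A := hAc.csInf_mem hAne hAbdd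
    have hbH : b ∉ H := hbA.2
    have hbgt : h₂ < b := lt_of_le_of_ne hbA.1.1 fun h ↦ hbH (h.symm ▸ hh₂)
    have hblt : b < s := (csInf_le hAbdd ht'A).trans_lt ht'.2
    have hIco : ∀ t, h₂ ≤ t → t < b → t ∈ H := fun t hth hbt ↦ by
      by_contra htH
      have : b ≤ t := csInf_le hAbdd ⟨⟨hth, hbt.le.trans hbA.1.2⟩, htH⟩
      linarith
    have hbcl : b ∈ closure H := by
      rw [Metric.mem_closure_iff]
      intro ε hε
      set t₀ := max (b - ε / 2) h₂ with ht₀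
      have h1 : t₀ < b := max_lt (by linarith) hbgt
      have h2 : b - ε / 2 ≤ t₀ := le_max_left _ _
      refine ⟨t₀, hIco _ (le_max_right _ _) h1, ?_⟩
      rw [Real.dist_eq, abs_of_pos (by linarith)]
      linarith
    obtain ⟨h₁, hh₁, hbh₁, hh₁s⟩ := hdown (s - b) (by linarith)
    exact hsep hbH hbcl (ne_of_lt hblt) (by rw [abs_of_neg (by linarith)]; linarith) hh₁ hh₂ hbgt (by linarith)
  -- Step E: accumulation from above or from below
  by_cases hup : ∀ ε > (0 : ℝ), ∃ t ∈ H, s < t ∧ t < s + ε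
  · obtain ⟨δ, hδ, hsub⟩ := habove hup
    exact ⟨δ, hδ, Or.inl fun t ht ↦ hsub ht⟩
  · push Not at hup
    obtain ⟨ε₀, hε₀, hnoup⟩ := hup
    have hdown : ∀ ε > (0 : ℝ), ∃ t ∈ H, s - ε < t ∧ t < s := by
      intro ε hε
      obtain ⟨t, htH, htε⟩ := hacc (min ε ε₀) (lt_min hε hε₀)
      have hts : t ≠ s := fun h ↦ hsH (h ▸ htH)
      rw [abs_lt] at htε
      have h1 := min_le_left ε ε₀
      have h2 := min_le_right ε ε₀
      rcases lt_or_gt_of_ne hts with hlt | hgt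
      · exact ⟨t, htH, by linarith [htε.1], hlt⟩
      · exact absurd (hnoup t htH hgt) (by linarith [htε.2])
    obtain ⟨δ, hδ, hsub⟩ := hbelow hdown
    exact ⟨δ, hδ, Or.inr fun t ht ↦ hsub ht⟩

end PunctureData

end Literature.Topology.PlanarFoliations
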